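import Literature.Geometry.Lorentzian.KerrEnergyIdentity
import Summits.FinalStateConjecture.FinalStateConjecture.Theorems.ClusterCompletenessAdiabaticMultiKerrILEDZoneKinematics

/-!
# Route ClusterCompleteness — crux `AdiabaticMultiKerrILED`, line `Sketch`: slice/leaf correspondence

Helper file for the crux `stmt-FinalStateConjecture-14310`
(`Summit.FinalStateConjecture.FinalStateConjecture.Theses.ClusterCompleteness.AdiabaticMultiKerrILED`),
closing the stub `stub_sliceLeafCorrespondence` of line `Sketch`.

A hole in inertial motion `(Λ, p)` has `4`-velocity `u = Λ e₀`, rest-frame coordinates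
`q x = Λ⁻¹ (x − (0, p))` of the lab point `x` (`poincareInv`) and inverse map `P w = Λ w + (0, p)`.
The assembly of the line transports the rest-frame red-shift estimate (stated on graph leaves
`{z⁰ = s + F(z⃗)}`) to the lab frame; this file packages the change-of-variables facts it needs:

* with `ũ = Λ⁻¹ e₀` (`ũ⁰ = u⁰`, `‖ũ⃗‖ = ‖u⃗‖`) and the linear height `F(y') = ⟪ũ⃗, y'⟫ / u⁰` one has
  `(q x)⁰ = x⁰ / u⁰ + F((q x)⃗)`, because `x⁰ = (Λ z)⁰ = −η(e₀, Λ z) = −η(ũ, z) = ũ⁰ z⁰ − ⟪ũ⃗, z⃗⟫`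
  for `z = q x`; the slope of `F` is `‖u⃗‖ / u⁰ ≤ 1/2` when the lab speed is `≤ 1/2`;
* `y ↦ (q (t, y))⃗` is affine with injective (boosts stretch spatial vectors) linear part
  `A = spatial ∘ Λ⁻¹ ∘ (0, ·)`, so `∫ g(q(t, y)) dy = |det A|⁻¹ ∫ g(t/u⁰ + F(y'), y') dy'` for every
  `g ≥ 0` (translation invariance and `Measure.map_linearMap_addHaar_eq_smul_addHaar`, through the
  measurable equivalence of `A`, hence without measurability assumptions on `g`);
* `∫_{t₁}^{t₂} f((t − t₁)/u⁰) dt = u⁰ ∫_0^{(t₂−t₁)/u⁰} f` (translation and dilation on `ℝ`);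
* `d(ψ ∘ P)_{q x} = dψ_x ∘ Λ` and `dψ_x = d(ψ ∘ P)_{q x} ∘ Λ⁻¹`, whence the sums of squared coordinate
  derivatives of `ψ` at `x` and of `ψ ∘ P` at `q x` are comparable with the constant
  `κ = Σ_{μν} (Λ e_μ)ν² + Σ_{μν} (Λ⁻¹ e_μ)ν² + 1` (Cauchy–Schwarz).

Special relativity folklore (O'Neill 1983, Ch. 9, pp. 233–236 for `O(1,3)` and Poincaré maps);
Mathlib for the change of variables in the Lebesgue integral. [folklore]
-/

noncomputable section

-- the doubled `FinalStateConjecture.FinalStateConjecture` path component trips dupNamespace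
set_option linter.dupNamespace false

open scoped ContDiff Topology BigOperators ENNReal InnerProductSpace
open Filter Set MeasureTheory Literature.Geometry.Lorentzian

namespace Summit.FinalStateConjecture.FinalStateConjecture.Cruxes.AdiabaticMultiKerrILED.Sketch

/-! ### Lorentz kinematics of the time coordinate -/

/-- `(Λ z)⁰ = u⁰ z⁰ − ⟪(Λ⁻¹e₀)⃗, z⃗⟫` with `u = Λ e₀`: indeed `(Λ z)⁰ = −η(e₀, Λ z) = −η(Λ⁻¹ e₀, z)` by
invariance, and `(Λ⁻¹ e₀)⁰ = (Λ e₀)⁰` (O'Neill 1983, Ch. 9, p. 233). [folklore] -/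
private theorem lorentz_apply_zero_eq (Λ : lorentzGroup) (z : E4) :
    ((Λ : E4 ≃L[ℝ] E4) z) 0 =
      ((Λ : E4 ≃L[ℝ] E4) (E4.basisVector 0)) 0 * z 0 -
        ⟪E4.spatial ((Λ : E4 ≃L[ℝ] E4).symm (E4.basisVector 0)), E4.spatial z⟫_ℝ := by
  -- `(Λ z)⁰ = −η(e₀, Λ z) = −η(Λ ũ, Λ z) = −η(ũ, z)`
  have h1 := Theorems.minkowski_bilin_basisVector_zero_left ((Λ : E4 ≃L[ℝ] E4) z)
  have h2 := Λ.2 ((Λ : E4 ≃L[ℝ] E4).symm (E4.basisVector 0)) z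
  rw [ContinuousLinearEquiv.apply_symm_apply] at h2
  -- `η(ũ, z) = −ũ⁰ z⁰ + ⟪ũ⃗, z⃗⟫`
  have h3 : Minkowski.bilin ((Λ : E4 ≃L[ℝ] E4).symm (E4.basisVector 0)) z =
      -(((Λ : E4 ≃L[ℝ] E4).symm (E4.basisVector 0)) 0 * z 0) +
        ⟪E4.spatial ((Λ : E4 ≃L[ℝ] E4).symm (E4.basisVector 0)), E4.spatial z⟫_ℝ := by
    rw [Minkowski.bilin_apply, PiLp.inner_apply]
    congr 1
    refine Finset.sum_congr rfl fun i _ ↦ ?_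
    simp [E4.spatial_apply, mul_comm]
  rw [Theorems.lorentz_symm_apply_basisVector_zero] at h3
  linarith

/-- `‖(Λ⁻¹ e₀)⃗‖ = ‖(Λ e₀)⃗‖`: both `4`-velocities are unit timelike with the same Lorentz factor
(O'Neill 1983, Ch. 9, p. 233; for boosts `γ(−v) = γ(v)`). [folklore] -/
private theorem norm_spatial_lorentz_symm_basisVector_zero (Λ : lorentzGroup) :
    ‖E4.spatial ((Λ : E4 ≃L[ℝ] E4).symm (E4.basisVector 0))‖ =
      ‖E4.spatial ((Λ : E4 ≃L[ℝ] E4) (E4.basisVector 0))‖ := by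
  have h1 := spatialNorm_sq_fourVelocity Λ⁻¹ rfl
  rw [Theorems.coe_lorentz_inv, Theorems.lorentz_symm_apply_basisVector_zero] at h1
  have h2 := spatialNorm_sq_fourVelocity Λ rfl
  rw [E4.spatialNorm] at h1 h2
  exact (sq_eq_sq₀ (norm_nonneg _) (norm_nonneg _)).mp (h1.trans h2.symm)

/-- The linear part `A = spatial ∘ Λ⁻¹ ∘ (0, ·)` of the slice-to-leaf map is injective: boosts
stretch spatial vectors, `‖y‖ ≤ ‖(Λ⁻¹ (0, y))⃗‖` (O'Neill 1983, Ch. 9, p. 233). [folklore] -/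
private theorem injective_sliceMap (Λ : lorentzGroup) :
    Function.Injective
      ((E4.spatial.comp ((Λ : E4 ≃L[ℝ] E4).symm : E4 →L[ℝ] E4)).comp E4.spaceEmbed) := by
  intro y₁ y₂ h
  rw [← sub_eq_zero, ← map_sub] at h
  rw [← sub_eq_zero, ← norm_le_zero_iff]
  have hw : (E4.spaceEmbed (y₁ - y₂)) 0 = 0 := by simp
  have h1 := Theorems.norm_le_spatialNorm_lorentz_apply Λ⁻¹ hw
  rw [Theorems.coe_lorentz_inv, E4.spatialNorm] at h1
  have h2 : ‖E4.spaceEmbed (y₁ - y₂)‖ = ‖y₁ - y₂‖ := by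
    rw [Theorems.norm_eq_spatialNorm_of_apply_zero_eq_zero hw, E4.spatialNorm, E4.spaceEmbed_apply,
      E4.spatial_ofTimeSpace]
  have h3 : E4.spatial ((Λ : E4 ≃L[ℝ] E4).symm (E4.spaceEmbed (y₁ - y₂))) = 0 := h
  rw [h3, norm_zero, h2] at h1
  exact h1

/-! ### Change of variables in the Lebesgue integral -/

/-- An injective linear endomorphism of `ℝ³` has nonzero determinant. [folklore] -/
private theorem det_ne_zero_of_injective (A : E3 →L[ℝ] E3) (hA : Function.Injective A) :
    LinearMap.det (A : E3 →ₗ[ℝ] E3) ≠ 0 :=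
  (LinearMap.isUnit_det _
    ((LinearMap.isUnit_iff_ker_eq_bot _).mpr (LinearMap.ker_eq_bot.mpr hA))).ne_zero

/-- **Affine change of variables on `ℝ³`** for an arbitrary (not necessarily measurable)
`h ≥ 0`: `∫ h(A y + b) dy = |det A|⁻¹ ∫ h` for an injective linear `A` (translation invariance of
Lebesgue measure and `Measure.map_linearMap_addHaar_eq_smul_addHaar`, transported through the
measurable equivalence induced by `A`). [folklore] -/
private theorem lintegral_comp_add_right_eq (A : E3 →L[ℝ] E3) (hA : Function.Injective A) (b : E3)
    (h : E3 → ℝ≥0∞) :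
    ∫⁻ y, h (A y + b) = ENNReal.ofReal |(LinearMap.det (A : E3 →ₗ[ℝ] E3))⁻¹| * ∫⁻ y, h y := by
  have hdet := det_ne_zero_of_injective A hA
  have h1 : ∫⁻ y, h (A y + b) = ∫⁻ y', h (y' + b) ∂(Measure.map (⇑(A : E3 →ₗ[ℝ] E3)) volume) := by
    rw [show (⇑(A : E3 →ₗ[ℝ] E3) : E3 → E3) =
        ⇑(LinearEquiv.ofInjectiveEndo (A : E3 →ₗ[ℝ] E3)
            hA).toContinuousLinearEquiv.toHomeomorph.toMeasurableEquiv from rfl,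
      lintegral_map_equiv]
    rfl
  rw [h1, Measure.map_linearMap_addHaar_eq_smul_addHaar volume hdet, lintegral_smul_measure,
    lintegral_add_right_eq_self, smul_eq_mul]

/-- Dilation change of variables for the lower Lebesgue integral on `ℝ`: `∫ G = a ∫ G(a s) ds` for
`a > 0`. [folklore] -/
private theorem lintegral_eq_ofReal_mul_lintegral_comp_mul (G : ℝ → ℝ≥0∞) {a : ℝ} (ha : 0 < a) :
    ∫⁻ t, G t = ENNReal.ofReal a * ∫⁻ s, G (a * s) := by
  -- adapted from `Literature/Probability/Process/BrownianBridgeToPoint3Lifetime.lean`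
  have h1 : ∫⁻ s, G (a * s) = ∫⁻ t, G t ∂(Measure.map (fun s ↦ a * s) volume) := by
    rw [show (fun s ↦ a * s) = ⇑(Homeomorph.mulLeft₀ a ha.ne').toMeasurableEquiv from rfl,
      lintegral_map_equiv]
    rfl
  rw [h1, Real.map_volume_mul_left ha.ne', lintegral_smul_measure, smul_eq_mul,
    abs_of_pos (inv_pos.2 ha), ← mul_assoc, ← ENNReal.ofReal_mul ha.le,
    mul_inv_cancel₀ ha.ne', ENNReal.ofReal_one, one_mul]

/-- **Affine substitution `s = (t − t₁)/c` in a time integral** (`c > 0`):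
`∫_{(t₁, t₂]} f((t − t₁)/c) dt = c ∫_{(0, (t₂ − t₁)/c]} f(s) ds`, for every `f ≥ 0`. [folklore] -/
private theorem setLIntegral_Ioc_comp_inv_mul_sub (f : ℝ → ℝ≥0∞) {c : ℝ} (hc : 0 < c) (t₁ t₂ : ℝ) :
    ∫⁻ t in Set.Ioc t₁ t₂, f (c⁻¹ * (t - t₁)) =
      ENNReal.ofReal c * ∫⁻ s in Set.Ioc 0 (c⁻¹ * (t₂ - t₁)), f s := by
  rw [← lintegral_indicator measurableSet_Ioc, ← lintegral_indicator measurableSet_Ioc]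
  -- translation `t = s + t₁`
  have h1 : ∀ s, (Set.Ioc t₁ t₂).indicator (fun t ↦ f (c⁻¹ * (t - t₁))) (s + t₁) =
      (Set.Ioc 0 (t₂ - t₁)).indicator (fun s ↦ f (c⁻¹ * s)) s := by
    intro s
    by_cases hs : s ∈ Set.Ioc 0 (t₂ - t₁)
    · have hs' : s + t₁ ∈ Set.Ioc t₁ t₂ := ⟨by linarith [hs.1], by linarith [hs.2]⟩
      rw [Set.indicator_of_mem hs', Set.indicator_of_mem hs, add_sub_cancel_right]
    · have hs' : s + t₁ ∉ Set.Ioc t₁ t₂ := fun h ↦ hs ⟨by linarith [h.1], by linarith [h.2]⟩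
      rw [Set.indicator_of_notMem hs', Set.indicator_of_notMem hs]
  -- dilation `s = c σ`
  have h2 : ∀ σ, (Set.Ioc 0 (t₂ - t₁)).indicator (fun s ↦ f (c⁻¹ * s)) (c * σ) =
      (Set.Ioc 0 (c⁻¹ * (t₂ - t₁))).indicator f σ := by
    intro σ
    by_cases hσ : σ ∈ Set.Ioc 0 (c⁻¹ * (t₂ - t₁))
    · have hσ' : c * σ ∈ Set.Ioc 0 (t₂ - t₁) := ⟨mul_pos hc hσ.1, (le_inv_mul_iff₀ hc).mp hσ.2⟩
      rw [Set.indicator_of_mem hσ', Set.indicator_of_mem hσ, inv_mul_cancel_left₀ hc.ne']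
    · have hσ' : c * σ ∉ Set.Ioc 0 (t₂ - t₁) := fun h ↦
        hσ ⟨pos_of_mul_pos_right h.1 hc.le, (le_inv_mul_iff₀ hc).mpr h.2⟩
      rw [Set.indicator_of_notMem hσ', Set.indicator_of_notMem hσ]
  calc ∫⁻ t, (Set.Ioc t₁ t₂).indicator (fun t ↦ f (c⁻¹ * (t - t₁))) t
      = ∫⁻ s, (Set.Ioc t₁ t₂).indicator (fun t ↦ f (c⁻¹ * (t - t₁))) (s + t₁) :=
        (lintegral_add_right_eq_self
          (fun t ↦ (Set.Ioc t₁ t₂).indicator (fun t ↦ f (c⁻¹ * (t - t₁))) t) t₁).symm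
    _ = ∫⁻ s, (Set.Ioc 0 (t₂ - t₁)).indicator (fun s ↦ f (c⁻¹ * s)) s := by simp_rw [h1]
    _ = ENNReal.ofReal c * ∫⁻ σ, (Set.Ioc 0 (t₂ - t₁)).indicator (fun s ↦ f (c⁻¹ * s)) (c * σ) :=
        lintegral_eq_ofReal_mul_lintegral_comp_mul _ hc
    _ = ENNReal.ofReal c * ∫⁻ σ, (Set.Ioc 0 (c⁻¹ * (t₂ - t₁))).indicator f σ := by simp_rw [h2]

/-! ### Comparability of coordinate gradients under a linear change of frame -/

/-- Cauchy–Schwarz in the coordinate basis: `Σ_μ (φ(T e_μ))² ≤ (Σ_{μν} (T e_μ)ν²) Σ_ν φ(e_ν)²`,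
from `φ(T e_μ) = Σ_ν (T e_μ)^ν φ(e_ν)`. [folklore] -/
private theorem sum_sq_comp_le (φ : E4 →L[ℝ] ℝ) (T : E4 →L[ℝ] E4) :
    ∑ μ, (φ.comp T (E4.basisVector μ)) ^ 2 ≤
      (∑ μ, ∑ ν, (T (E4.basisVector μ) ν) ^ 2) * ∑ ν, (φ (E4.basisVector ν)) ^ 2 := by
  rw [Finset.sum_mul]
  refine Finset.sum_le_sum fun μ _ ↦ ?_
  have h : φ.comp T (E4.basisVector μ) = ∑ ν, T (E4.basisVector μ) ν * φ (E4.basisVector ν) := by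
    rw [ContinuousLinearMap.comp_apply]
    conv_lhs => rw [Kerr.eq_sum_basisVector (T (E4.basisVector μ)), map_sum]
    simp only [map_smul, smul_eq_mul]
  rw [h]
  exact Finset.sum_mul_sq_le_sq_mul_sq _ _ _

/-- **Chain rule for the Poincaré map** `P w = Λ w + c`: since `P (q x) = x` for `q = poincareInv Λ c`,
`d(ψ ∘ P)_{q x} = dψ_x ∘ Λ` whenever `ψ` is differentiable at `x` (O'Neill 1983, Ch. 9, p. 236).
[folklore] -/
private theorem fderiv_comp_poincare (Λ : lorentzGroup) (c : E4) {ψ : E4 → ℝ} {x : E4}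
    (hψ : DifferentiableAt ℝ ψ x) :
    fderiv ℝ (fun w ↦ ψ ((Λ : E4 ≃L[ℝ] E4) w + c)) (poincareInv Λ c x) =
      (fderiv ℝ ψ x).comp ((Λ : E4 ≃L[ℝ] E4) : E4 →L[ℝ] E4) := by
  have hP : HasFDerivAt (fun w : E4 ↦ (Λ : E4 ≃L[ℝ] E4) w + c) ((Λ : E4 ≃L[ℝ] E4) : E4 →L[ℝ] E4)
      (poincareInv Λ c x) :=
    ((Λ : E4 ≃L[ℝ] E4) : E4 →L[ℝ] E4).hasFDerivAt.add_const c
  have hx : (Λ : E4 ≃L[ℝ] E4) (poincareInv Λ c x) + c = x := by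
    rw [poincareInv, ContinuousLinearEquiv.apply_symm_apply, sub_add_cancel]
  have hψ' : HasFDerivAt ψ (fderiv ℝ ψ x) ((Λ : E4 ≃L[ℝ] E4) (poincareInv Λ c x) + c) := by
    rw [hx]
    exact hψ.hasFDerivAt
  exact (HasFDerivAt.comp (poincareInv Λ c x) (f := fun w : E4 ↦ (Λ : E4 ≃L[ℝ] E4) w + c)
    hψ' hP).fderiv

/-! ### The stub -/

/-- **Lab slices are affine images of linear rest-frame leaves** (classical stub W3 of line `Sketch`).
For a hole in inertial motion (`u = Λe₀`, `q = Λ⁻¹(· − (0,p))`, lab speed `≤ u⁰/2`) there are a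
linear height `F(y') = ⟪(Λ⁻¹e₀)⃗, y'⟫/u⁰` of slope `‖u⃗‖/u⁰ ≤ 1/2`, a Jacobian `J > 0` and a
comparability constant `κ > 0` with: `(q x)⁰ = x⁰/u⁰ + F((q x)⃗)`;
`∫ g(q(t,y)) dy = J ∫ g(t/u⁰ + F(y'), y') dy'` for every `g ≥ 0`;
`∫_{t₁}^{t₂} f((t − t₁)/u⁰) dt = u⁰ ∫_0^{(t₂−t₁)/u⁰} f`; and the coordinate gradients of `ψ` at `x`
and of `ψ ∘ P` at `q x` (`P w = Λ w + (0, p)`) are `κ`-comparable (`d(ψ∘P)_{qx} = dψ_x ∘ Λ`).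
O'Neill 1983, Ch. 9 (Poincaré maps); Mathlib `Measure.map_linearMap_addHaar_eq_smul_addHaar`.
[folklore] -/
theorem stub_sliceLeafCorrespondence :
    ∀ (Λ : lorentzGroup) (p : E3) (u : E4) (q : E4 → E4),
      u = (Λ : E4 ≃L[ℝ] E4) (E4.basisVector 0) → (∀ x, q x = poincareInv Λ (E4.ofTimeSpace 0 p) x) →
      0 < u 0 → ‖E4.spatial u‖ ≤ 2⁻¹ * u 0 →
      ∃ (F : E3 → ℝ) (J κ : ℝ), 0 < J ∧ 0 < κ ∧ ContDiff ℝ ∞ F ∧ (∀ y, ‖fderiv ℝ F y‖ ≤ 2⁻¹) ∧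
        (∀ x : E4, q x 0 = (u 0)⁻¹ * x 0 + F (E4.spatial (q x))) ∧
        (∀ (g : E4 → ℝ≥0∞) (t : ℝ), ∫⁻ y : E3, g (q (E4.ofTimeSpace t y)) =
          ENNReal.ofReal J * ∫⁻ y' : E3, g (E4.ofTimeSpace ((u 0)⁻¹ * t + F y') y')) ∧
        (∀ (f : ℝ → ℝ≥0∞) (t₁ t₂ : ℝ), t₁ ≤ t₂ →
          ∫⁻ t in Set.Ioc t₁ t₂, f ((u 0)⁻¹ * (t - t₁)) =
            ENNReal.ofReal (u 0) * ∫⁻ s in Set.Ioc 0 ((u 0)⁻¹ * (t₂ - t₁)), f s) ∧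
        (∀ (ψ : E4 → ℝ) (x : E4), DifferentiableAt ℝ ψ x →
          ∑ μ, (fderiv ℝ (fun w ↦ ψ ((Λ : E4 ≃L[ℝ] E4) w + E4.ofTimeSpace 0 p)) (q x)
              (E4.basisVector μ)) ^ 2 ≤ κ * ∑ μ, (fderiv ℝ ψ x (E4.basisVector μ)) ^ 2 ∧
          ∑ μ, (fderiv ℝ ψ x (E4.basisVector μ)) ^ 2 ≤
            κ * ∑ μ, (fderiv ℝ (fun w ↦ ψ ((Λ : E4 ≃L[ℝ] E4) w + E4.ofTimeSpace 0 p)) (q x)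
              (E4.basisVector μ)) ^ 2) := by
  intro Λ p u q hu hq hu0 hus
  have hL0 : ((Λ : E4 ≃L[ℝ] E4) (E4.basisVector 0)) 0 = u 0 := by rw [hu]
  -- the linear height `F = ℓ = ⟪ũ⃗, ·⟫ / u⁰`, `ũ = Λ⁻¹ e₀`
  obtain ⟨ℓ, hℓ, hℓn⟩ : ∃ ℓ : E3 →L[ℝ] ℝ,
      (∀ y', ℓ y' = (u 0)⁻¹ * ⟪E4.spatial ((Λ : E4 ≃L[ℝ] E4).symm (E4.basisVector 0)), y'⟫_ℝ) ∧
        ‖ℓ‖ ≤ 2⁻¹ := by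
    refine ⟨(u 0)⁻¹ • innerSL ℝ (E4.spatial ((Λ : E4 ≃L[ℝ] E4).symm (E4.basisVector 0))),
      fun y' ↦ by simp [innerSL_apply_apply], ?_⟩
    rw [norm_smul, innerSL_apply_norm, norm_spatial_lorentz_symm_basisVector_zero, ← hu,
      Real.norm_eq_abs, abs_of_pos (inv_pos.2 hu0)]
    calc (u 0)⁻¹ * ‖E4.spatial u‖ ≤ (u 0)⁻¹ * (2⁻¹ * u 0) :=
          mul_le_mul_of_nonneg_left hus (inv_pos.2 hu0).le
      _ = 2⁻¹ := by field_simp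
  -- the linear part `A = spatial ∘ Λ⁻¹ ∘ (0, ·)` of the slice-to-leaf map
  obtain ⟨A, hA, hAi⟩ : ∃ A : E3 →L[ℝ] E3,
      (∀ y, A y = E4.spatial ((Λ : E4 ≃L[ℝ] E4).symm (E4.spaceEmbed y))) ∧ Function.Injective A :=
    ⟨_, fun _ ↦ rfl, injective_sliceMap Λ⟩
  -- the time coordinate in the rest frame
  have htime : ∀ x : E4, q x 0 = (u 0)⁻¹ * x 0 + ℓ (E4.spatial (q x)) := by
    intro x
    have h1 := lorentz_apply_zero_eq Λ (q x)
    have h2 : (Λ : E4 ≃L[ℝ] E4) (q x) = x - E4.ofTimeSpace 0 p := by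
      rw [hq, poincareInv, ContinuousLinearEquiv.apply_symm_apply]
    rw [h2, hL0] at h1
    have h3 : (x - E4.ofTimeSpace 0 p) 0 = x 0 := by simp
    rw [h3] at h1
    have h4 : x 0 + ⟪E4.spatial ((Λ : E4 ≃L[ℝ] E4).symm (E4.basisVector 0)), E4.spatial (q x)⟫_ℝ =
        u 0 * q x 0 := by linarith
    rw [hℓ, ← mul_add, h4, inv_mul_cancel_left₀ hu0.ne']
  -- nonnegative comparability constants
  have hκ₁ : 0 ≤ ∑ μ, ∑ ν, (((Λ : E4 ≃L[ℝ] E4) : E4 →L[ℝ] E4) (E4.basisVector μ) ν) ^ 2 :=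
    Finset.sum_nonneg fun _ _ ↦ Finset.sum_nonneg fun _ _ ↦ sq_nonneg _
  have hκ₂ : 0 ≤ ∑ μ, ∑ ν, (((Λ : E4 ≃L[ℝ] E4).symm : E4 →L[ℝ] E4) (E4.basisVector μ) ν) ^ 2 :=
    Finset.sum_nonneg fun _ _ ↦ Finset.sum_nonneg fun _ _ ↦ sq_nonneg _
  refine ⟨ℓ, |(LinearMap.det (A : E3 →ₗ[ℝ] E3))⁻¹|,
    ∑ μ, ∑ ν, (((Λ : E4 ≃L[ℝ] E4) : E4 →L[ℝ] E4) (E4.basisVector μ) ν) ^ 2 +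
      ∑ μ, ∑ ν, (((Λ : E4 ≃L[ℝ] E4).symm : E4 →L[ℝ] E4) (E4.basisVector μ) ν) ^ 2 + 1,
    abs_pos.2 (inv_ne_zero (det_ne_zero_of_injective A hAi)), by linarith, ℓ.contDiff,
    fun y ↦ by rw [ℓ.fderiv]; exact hℓn, htime, ?_,
    fun f t₁ t₂ _ ↦ setLIntegral_Ioc_comp_inv_mul_sub f hu0 t₁ t₂, ?_⟩
  · -- slice integrals
    intro g t
    obtain ⟨b, hb⟩ : ∃ b : E3,
        b = E4.spatial ((Λ : E4 ≃L[ℝ] E4).symm (t • E4.basisVector 0 - E4.ofTimeSpace 0 p)) :=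
      ⟨_, rfl⟩
    have hpt : ∀ y, q (E4.ofTimeSpace t y) = E4.ofTimeSpace ((u 0)⁻¹ * t + ℓ (A y + b)) (A y + b) := by
      intro y
      have hsp : E4.spatial (q (E4.ofTimeSpace t y)) = A y + b := by
        rw [hq, poincareInv, hA, hb, ← map_add, ← map_add, E4.ofTimeSpace_eq_smul_add' t y]
        congr 2
        abel
      have h0 := htime (E4.ofTimeSpace t y)
      rw [E4.ofTimeSpace_apply_zero, hsp] at h0
      calc q (E4.ofTimeSpace t y)
          = E4.ofTimeSpace (E4.time (q (E4.ofTimeSpace t y))) (E4.spatial (q (E4.ofTimeSpace t y))) :=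
            (E4.ofTimeSpace_time_spatial _).symm
        _ = E4.ofTimeSpace ((u 0)⁻¹ * t + ℓ (A y + b)) (A y + b) := by rw [E4.time_apply, h0, hsp]
    simp_rw [hpt]
    exact lintegral_comp_add_right_eq A hAi b (fun y' ↦ g (E4.ofTimeSpace ((u 0)⁻¹ * t + ℓ y') y'))
  · -- comparability of gradients
    intro ψ x hψ
    have hD : fderiv ℝ (fun w ↦ ψ ((Λ : E4 ≃L[ℝ] E4) w + E4.ofTimeSpace 0 p)) (q x) =
        (fderiv ℝ ψ x).comp ((Λ : E4 ≃L[ℝ] E4) : E4 →L[ℝ] E4) := by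
      rw [hq]
      exact fderiv_comp_poincare Λ _ hψ
    have hD' : fderiv ℝ ψ x =
        (fderiv ℝ (fun w ↦ ψ ((Λ : E4 ≃L[ℝ] E4) w + E4.ofTimeSpace 0 p)) (q x)).comp
          ((Λ : E4 ≃L[ℝ] E4).symm : E4 →L[ℝ] E4) := by
      rw [hD]
      ext v
      simp
    have hS := sum_sq_comp_le (fderiv ℝ ψ x) ((Λ : E4 ≃L[ℝ] E4) : E4 →L[ℝ] E4)
    rw [← hD] at hS
    have hS' := sum_sq_comp_le (fderiv ℝ (fun w ↦ ψ ((Λ : E4 ≃L[ℝ] E4) w + E4.ofTimeSpace 0 p)) (q x))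
      ((Λ : E4 ≃L[ℝ] E4).symm : E4 →L[ℝ] E4)
    rw [← hD'] at hS'
    have hN : 0 ≤ ∑ ν, (fderiv ℝ ψ x (E4.basisVector ν)) ^ 2 :=
      Finset.sum_nonneg fun _ _ ↦ sq_nonneg _
    have hN' : 0 ≤ ∑ ν, (fderiv ℝ (fun w ↦ ψ ((Λ : E4 ≃L[ℝ] E4) w + E4.ofTimeSpace 0 p)) (q x)
        (E4.basisVector ν)) ^ 2 :=
      Finset.sum_nonneg fun _ _ ↦ sq_nonneg _
    constructor
    · refine hS.trans (mul_le_mul_of_nonneg_right ?_ hN)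
      linarith
    · refine hS'.trans (mul_le_mul_of_nonneg_right ?_ hN')
      linarith

end Summit.FinalStateConjecture.FinalStateConjecture.Cruxes.AdiabaticMultiKerrILED.Sketch

end
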